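/-
Copyright (c) 2026 the pub-hodgecm-mathlib formalisation cell (harness21).  Prover seat hodgecm-mathlib-K2Liu-p06 (g4), Track B «K2-LIT»,
#184♮ = hLiu418 = `stmt-HodgeConjecture-24832`; #42S payer road, organ S1 (local Siegel–Weil spanning), ROAD W file F3b (census
`K2/K2Liu-p06/g4/CENSUS-S1-LocalSWSpanning.K2Liu-p06-g4.md` §0 (SC), §8; RULING «M-157t» (2),(4)).
-/
import Summits.HodgeConjecture.HodgeConjecture.Theorems.K2LiuLocalSWBigCellLattice   -- ★ F3a (W2) `mem_of_indicator_profile_mem`, `exists_indicator_profile_mem`; ★ F2 (W1)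
import HarnessLib

/-!
# Crux `HLiu418`, #42S organ S1, ROAD W, file F3b: THE SPANNING CRITERION (SC) = (W1) ★ F2 + (W2) ★ F3a
# (an `H`-stable subspace of `I_v(s, χ_v)` containing ONE big-cell section with NON-ZERO PROFILE SUM is everything)

Cell `hodgecm-mathlib`, crux item hLiu418 = `stmt-HodgeConjecture-24832`; squad K2 ∕ K2Liu; prover K2Liu-p06 (g4), the dedicated S1 hand.
THEOREMS ONLY (no `def`, no instance, no notation, no named-fact hypothesis, no `sorry`); lane `--supports stmt-HodgeConjecture-24832 --as helper`.

* §1 (ANY topological group `G`; `P, N ≤ G`, `N` commutative, `w ∈ G`, big cell `Ω = P w N` OPEN with a continuous `N`-coordinate `ν`, Iwasawa compact `K₀`,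
  contracting Levi elements BY VALUE): (L0) `exists_compact_profile_support` (a smooth section vanishing off `Ω` has compactly supported profile — the witness
  file's entry to `spanning_criterion`), `bigCell_pieces_mem_of_indicator_profile_mem` ((W2) in the shape ★ F2's `hUΩ` consumes) and **`spanning_criterion`**:
  if a right-translation-stable `U ≤ (G → ℂ)` contains ONE `f₀` with the left law `χ`, vanishing off `Ω`, right-`N₀`-invariant, profile supported in `N₁` with
  `Σ_{q ∈ N₁∕N₀} f₀ (w q̃) ≠ 0`, then `U` contains every function with the law `χ` and an open stabiliser.  [BernsteinZelevinsky1976, §1.5, §2.2]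
* §2 (the doubled group `H_v` of the K2Liu datum at a finite place): the three BRIDGES the instance file F7 needs to read §1 in ★ D1 `localDegPS` currency —
  `localSiegelCharacter_ne_zero` on `siegelDeltaLoc v` (★ `isUnit_localDetDelta_of_mem_siegelDeltaLoc`), `isLocalSiegelSection_iff_law` (★ `mem_siegelDeltaLoc_iff_local`),
  `isSmooth_iff_exists_subgroup`.  `N_Δ`, `w_Δ`, `Ω`, `ν`, `m(t)` stay BY VALUE as in ★ F2 §2 (F7 discharges them with ★ `unipDeltaLoc`, ★ `K2LiuSiegelBruhatCells.bigCell_eq`).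
References: [BernsteinZelevinsky1976] §1.1–1.5, §2.2; [Casselman1995] §3.1, §6.1; [HarrisKudlaSweet1996] §1 (1.15); [KudlaSweet1997] Thm 1.2 (the spanning ROAD W pays — NOT used).
HONEST LABEL.  Count-neutral helper: `HC_CM` is proved only modulo the 7 printed citations (2 remaining named inputs: hLiu418 = `stmt-HodgeConjecture-24832`,
h413 = `stmt-HodgeConjecture-24833`) until rung 0 closes.
-/

set_option autoImplicit false
set_option linter.dupNamespace false -- the mandated namespace repeats `HodgeConjecture.HodgeConjecture`

noncomputable section

open NumberField IsDedekindDomain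
open scoped Matrix Pointwise

namespace Summit.HodgeConjecture.HodgeConjecture.Cruxes.HLiu418.K2LiuLocalSWSpanningCriterion

open Literature.NumberTheory.Automorphic
open Literature.NumberTheory.GelbartRogawski1991 Literature.NumberTheory.GelbartRogawski1991.GRConstruction
open Literature.NumberTheory.GelbartRogawski1991.UnitaryDualPair
open Literature.NumberTheory.K2Lit.SiegelDoubled Literature.NumberTheory.K2Lit.LocalSiegelDoubled
open Summit.HodgeConjecture.HodgeConjecture.Cruxes.HLiu418.K2LiuLocalSWBigCellGeneration
open Summit.HodgeConjecture.HodgeConjecture.Cruxes.HLiu418.K2LiuLocalSWBigCellLattice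

/-! ## §1 Abstract: (SC) -/

section Abstract

variable {G : Type*} [Group G] [TopologicalSpace G] [IsTopologicalGroup G]


omit [TopologicalSpace G] [IsTopologicalGroup G] in
/-- the profile support of a section supported in `P·C`, `C ⊆ Ω` compact, is contained in the compact `ν(C)` when `ν` is a continuous `N`-coordinate on `Ω`.
[cite: BernsteinZelevinsky1976, §1.5] -/
theorem profile_support_subset_image {P N : Subgroup G} {w : G} {ν : G → G}
    (hν : ∀ p ∈ P, ∀ n ∈ N, ν (p * w * n) = n) {F : G → ℂ} {C : Set G}
    (hFC : ∀ h, F h ≠ 0 → ∃ p ∈ P, ∃ c ∈ C, h = p * c) (n : G) (hn : n ∈ N) (hFn : F (w * n) ≠ 0) : n ∈ ν '' C := by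
  obtain ⟨p, hp, c, hc, hpc⟩ := hFC _ hFn
  refine ⟨c, hc, ?_⟩
  have : c = p⁻¹ * w * n := by rw [mul_assoc, hpc, ← mul_assoc, inv_mul_cancel, one_mul]
  rw [this]
  exact hν _ (P.inv_mem hp) n hn

omit [TopologicalSpace G] [IsTopologicalGroup G] in
/-- a section supported in `P·C` with `C ⊆ Ω = P w N` vanishes off `Ω`. [cite: BernsteinZelevinsky1976, §1.5] -/
theorem offCell_of_support {P N : Subgroup G} {w : G} {F : G → ℂ} {C : Set G}
    (hCΩ : ∀ c ∈ C, ∃ p ∈ P, ∃ n ∈ N, c = p * w * n) (hFC : ∀ h, F h ≠ 0 → ∃ p ∈ P, ∃ c ∈ C, h = p * c)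
    (h : G) (hh : ¬ ∃ p ∈ P, ∃ n ∈ N, h = p * w * n) : F h = 0 := by
  by_contra hne
  obtain ⟨p, hp, c, hc, rfl⟩ := hFC h hne
  obtain ⟨p', hp', n, hn, rfl⟩ := hCΩ c hc
  exact hh ⟨p * p', P.mul_mem hp hp', n, hn, by group⟩

/-- **(L0) A SMOOTH SECTION VANISHING OFF THE BIG CELL HAS COMPACTLY SUPPORTED PROFILE.**  With an Iwasawa compact `K₀` (`G = P·K₀`) and a continuous
`N`-coordinate `ν` on `Ω = P w N`: if `f` has the left law `χ`, is right-invariant under an open subgroup `V` and vanishes off `Ω`, then its profile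
`n ↦ f (w n)` is supported in the compact `ν(K₀ ∖ Z·V) ⊆ N` (`Z = G ∖ Ω`; `f` vanishes on the open `Z·V ⊇ Z`). [cite: BernsteinZelevinsky1976, §1.5] -/
theorem exists_compact_profile_support {P N : Subgroup G} {χ : G → ℂ} {K₀ : Set G} (hK₀ : IsCompact K₀)
    (hIw : ∀ g : G, ∃ p ∈ P, ∃ k ∈ K₀, g = p * k)
    {w : G} {ν : G → G} (hνc : ContinuousOn ν {h | ∃ p ∈ P, ∃ n ∈ N, h = p * w * n})
    (hν : ∀ p ∈ P, ∀ n ∈ N, ν (p * w * n) = n) {f : G → ℂ} (hf : ∀ p ∈ P, ∀ h, f (p * h) = χ p * f h)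
    (hfs : ∃ V : Subgroup G, IsOpen (V : Set G) ∧ ∀ h, ∀ u ∈ V, f (h * u) = f h)
    (hfoff : ∀ h, (¬ ∃ p ∈ P, ∃ n ∈ N, h = p * w * n) → f h = 0) :
    ∃ S₀ : Set G, IsCompact S₀ ∧ S₀ ⊆ N ∧ ∀ n ∈ N, f (w * n) ≠ 0 → n ∈ S₀ := by
  obtain ⟨V, hVo, hV⟩ := hfs
  set Ω : Set G := {h | ∃ p ∈ P, ∃ n ∈ N, h = p * w * n} with hΩdef
  -- the open neighbourhood `W = Z·V` of `Z = Ωᶜ`, on which `f` vanishes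
  set W : Set G := ⋃ z ∈ Ωᶜ, (fun u => z * u) '' (V : Set G) with hW
  have hWo : IsOpen W := isOpen_biUnion fun z _ => (Homeomorph.mulLeft z).isOpenMap _ hVo
  have hfW : ∀ h ∈ W, f h = 0 := by
    intro h hh
    simp only [hW, Set.mem_iUnion, Set.mem_image, exists_prop] at hh
    obtain ⟨z, hz, u, hu, rfl⟩ := hh
    rw [hV z u hu]
    exact hfoff z hz
  have hZW : Ωᶜ ⊆ W := fun z hz => Set.mem_biUnion hz ⟨1, V.one_mem, mul_one z⟩
  -- the compact `K₀ ∖ W ⊆ Ω`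
  have hcpt : IsCompact (K₀ \ W) := hK₀.diff hWo
  have hsub : K₀ \ W ⊆ Ω := fun k hk => by
    by_contra hkΩ
    exact hk.2 (hZW hkΩ)
  refine ⟨ν '' (K₀ \ W), hcpt.image_of_continuousOn (hνc.mono hsub), ?_, fun n hn hfn => ?_⟩
  · rintro _ ⟨k, hk, rfl⟩
    obtain ⟨p, hp, n, hn, rfl⟩ := hsub hk
    rw [hν p hp n hn]
    exact hn
  · obtain ⟨p, hp, k, hk, hwk⟩ := hIw (w * n)
    have hkeq : k = p⁻¹ * w * n := by rw [mul_assoc p⁻¹, hwk, ← mul_assoc, inv_mul_cancel, one_mul]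
    have hkW : k ∉ W := fun hkW => hfn (by rw [hwk, hf p hp, hfW k hkW, mul_zero])
    exact ⟨k, ⟨hk, hkW⟩, by rw [hkeq]; exact hν _ (P.inv_mem hp) n hn⟩

/-- **(W2) IN THE SHAPE ★ F2 CONSUMES**: under the hypotheses of `mem_of_indicator_profile_mem` packaged with a continuous `N`-coordinate `ν` on `Ω` and CONTRACTING
data chosen per open stabiliser (BY VALUE: `hcontr`), a right-translation-stable `U` containing the indicator-profile section `e` contains every function with the law
`χ`, an open stabiliser, and support in `P·C` for a compact `C ⊆ Ω`. [cite: BernsteinZelevinsky1976, §1.5, §2.2] [cite: Casselman1995, §6.1] -/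
theorem bigCell_pieces_mem_of_indicator_profile_mem {P N N₁ : Subgroup G} (hN : ∀ x ∈ N, ∀ y ∈ N, x * y = y * x) (h1N : N₁ ≤ N)
    {χ : G → ℂ} (hχ : ∀ p ∈ P, χ p ≠ 0) {w : G} {ν : G → G} (hνc : ContinuousOn ν {h | ∃ p ∈ P, ∃ n ∈ N, h = p * w * n})
    (hν : ∀ p ∈ P, ∀ n ∈ N, ν (p * w * n) = n)
    (hcontr : ∀ V : Subgroup G, IsOpen (V : Set G) → ∃ m pm : G, pm ∈ P ∧ w * m = pm * w ∧ (∀ n ∈ N, m * n * m⁻¹ ∈ N) ∧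
      (∀ n ∈ N, m⁻¹ * n * m ∈ N) ∧ (∀ u ∈ N, m⁻¹ * u * m ∈ N₁ → u ∈ V) ∧
      ∃ O : Set G, IsOpen O ∧ (1 : G) ∈ O ∧ ∀ x ∈ O, x ∈ N → m⁻¹ * x * m ∈ N₁)
    (U : Submodule ℂ (G → ℂ)) (hU : ∀ F ∈ U, ∀ g : G, (fun h => F (h * g)) ∈ U)
    {e : G → ℂ} (heU : e ∈ U) (he : ∀ p ∈ P, ∀ h, e (p * h) = χ p * e h)
    (heoff : ∀ h, (¬ ∃ p ∈ P, ∃ n ∈ N, h = p * w * n) → e h = 0) {S : ℂ} (hS : S ≠ 0)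
    (heon : ∀ n ∈ N₁, e (w * n) = S) (heout : ∀ n ∈ N, n ∉ N₁ → e (w * n) = 0)
    (F : G → ℂ) (hF : ∀ p ∈ P, ∀ h, F (p * h) = χ p * F h)
    (hFs : ∃ V : Subgroup G, IsOpen (V : Set G) ∧ ∀ h, ∀ u ∈ V, F (h * u) = F h)
    (hFC : ∃ C : Set G, IsCompact C ∧ C ⊆ {h | ∃ p ∈ P, ∃ n ∈ N, h = p * w * n} ∧ ∀ h, F h ≠ 0 → ∃ p ∈ P, ∃ c ∈ C, h = p * c) :
    F ∈ U := by
  obtain ⟨V, hVo, hV⟩ := hFs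
  obtain ⟨C, hC, hCΩ, hFC⟩ := hFC
  obtain ⟨m, pm, hpm, hwm, hconj, hconj', hN₂V, O, hO, h1O, hON₂⟩ := hcontr V hVo
  refine mem_of_indicator_profile_mem hN h1N hχ U hU heU he heoff hS heon heout hpm hwm hconj hconj' hO h1O hON₂ F hF
    (offCell_of_support (fun c hc => hCΩ hc) hFC) (fun n hn u hu hu1 => ?_) (hC.image_of_continuousOn (hνc.mono hCΩ))
    (fun x hx => ?_) (fun n hn hFn => profile_support_subset_image hν hFC n hn hFn)
  · exact hV _ _ (hN₂V u hu hu1)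
  · obtain ⟨c, hc, rfl⟩ := hx
    obtain ⟨p, hp, n, hn, rfl⟩ := hCΩ hc
    rw [hν p hp n hn]
    exact hn

end Abstract

section Criterion

variable {G : Type*} [Group G] [TopologicalSpace G] [NonarchimedeanGroup G]

/-- **(SC) THE SPANNING CRITERION** (= (W1) ★ `mem_of_bigCell_pieces_mem` + (W2) + (W2′)).  `G` non-archimedean; `P, N ≤ G` with `N` commutative;
`w ∈ G` with the «big cell» `Ω = P w N` OPEN and carrying a continuous `N`-coordinate `ν`; an Iwasawa compact `K₀` (`G = P K₀`); `χ` non-vanishing on `P`;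
compact-open data `N₀ ≤ N₁ ≤ N` (`N₁ ∕ N₀` finite) with contracting elements BY VALUE (`hcontr`).  If a right-translation-stable `U ≤ (G → ℂ)` contains ONE
function `f₀` with the law `χ`, an open stabiliser, vanishing off `Ω`, right-`N₀`-invariant, with profile vanishing on `N ∖ N₁` and PROFILE SUM
`Σ_{q ∈ N₁∕N₀} f₀ (w q̃) ≠ 0`, then `U` contains EVERY function with the law `χ` and an open stabiliser.
[cite: BernsteinZelevinsky1976, §1.5, §2.2] [cite: Casselman1995, §6.1] [cite: KudlaSweet1997, Thm 1.2 (the use, not the statement)] -/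
theorem spanning_criterion {P N N₀ N₁ : Subgroup G} (hN : ∀ x ∈ N, ∀ y ∈ N, x * y = y * x)
    (h1N : N₁ ≤ N) [Fintype (N₁ ⧸ N₀.subgroupOf N₁)]
    {χ : G → ℂ} (hχ : ∀ p ∈ P, χ p ≠ 0) {K₀ : Set G} (hK₀ : IsCompact K₀) (hIw : ∀ g : G, ∃ p ∈ P, ∃ k ∈ K₀, g = p * k)
    {w : G} (hΩ : IsOpen {h | ∃ p ∈ P, ∃ n ∈ N, h = p * w * n})
    {ν : G → G} (hνc : ContinuousOn ν {h | ∃ p ∈ P, ∃ n ∈ N, h = p * w * n}) (hν : ∀ p ∈ P, ∀ n ∈ N, ν (p * w * n) = n)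
    (hcontr : ∀ V : Subgroup G, IsOpen (V : Set G) → ∃ m pm : G, pm ∈ P ∧ w * m = pm * w ∧ (∀ n ∈ N, m * n * m⁻¹ ∈ N) ∧
      (∀ n ∈ N, m⁻¹ * n * m ∈ N) ∧ (∀ u ∈ N, m⁻¹ * u * m ∈ N₁ → u ∈ V) ∧
      ∃ O : Set G, IsOpen O ∧ (1 : G) ∈ O ∧ ∀ x ∈ O, x ∈ N → m⁻¹ * x * m ∈ N₁)
    (U : Submodule ℂ (G → ℂ)) (hU : ∀ F ∈ U, ∀ g : G, (fun h => F (h * g)) ∈ U)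
    {f₀ : G → ℂ} (hf₀U : f₀ ∈ U) (hf₀ : ∀ p ∈ P, ∀ h, f₀ (p * h) = χ p * f₀ h)
    (hf₀off : ∀ h, (¬ ∃ p ∈ P, ∃ n ∈ N, h = p * w * n) → f₀ h = 0)
    (hf₀inv : ∀ h, ∀ u ∈ N₀, f₀ (h * u) = f₀ h) (hf₀out : ∀ n ∈ N, n ∉ N₁ → f₀ (w * n) = 0)
    (hsum : ∑ q : N₁ ⧸ N₀.subgroupOf N₁, f₀ (w * (q.out : G)) ≠ 0)
    (f : G → ℂ) (hf : ∀ p ∈ P, ∀ h, f (p * h) = χ p * f h)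
    (hfs : ∃ V : Subgroup G, IsOpen (V : Set G) ∧ ∀ h, ∀ u ∈ V, f (h * u) = f h) : f ∈ U := by
  obtain ⟨e, heU, he, heoff, heon, heout⟩ := exists_indicator_profile_mem h1N U hU hf₀U hf₀ hf₀off hf₀inv hf₀out
  have hPΩ : ∀ p ∈ P, ∀ x ∈ {h : G | ∃ p ∈ P, ∃ n ∈ N, h = p * w * n}, p * x ∈ {h : G | ∃ p ∈ P, ∃ n ∈ N, h = p * w * n} := by
    rintro p hp x ⟨p', hp', n, hn, rfl⟩
    exact ⟨p * p', P.mul_mem hp hp', n, hn, by group⟩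
  have hw : w ∈ {h : G | ∃ p ∈ P, ∃ n ∈ N, h = p * w * n} := ⟨1, P.one_mem, 1, N.one_mem, by group⟩
  exact mem_of_bigCell_pieces_mem hK₀ hIw hΩ hPΩ hw U hU
    (fun F hF hFs hFC => bigCell_pieces_mem_of_indicator_profile_mem hN h1N hχ hνc hν hcontr U hU heU he heoff hsum heon heout
      F hF hFs hFC) f hf hfs

end Criterion

/-! ## §2 The doubled group at a finite place: the criterion for `I_v(s, χ_v)` -/

section Local

variable (L : Type) [Field L] [NumberField L] [IsCMField L]
variable {N M n : ℕ} (e : Fin N × Fin M ≃ Fin n)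
  (dV : Fin N → L) (hdV : ∀ i, IsCMField.complexConj L (dV i) = dV i)
  (dW : Fin M → L) (hdW : ∀ i, IsCMField.complexConj L (dW i) = dW i)
variable (v : HeightOneSpectrum (𝓞 (Fp L)))

/-- **the local Siegel character never vanishes on `P_Δ(L⁺_v)`** (`χ_v(det_Δ p)` is a unit of `ℂ` and `|det_Δ p|_v > 0` by ★ `isUnit_localDetDelta_of_mem_siegelDeltaLoc`).
[cite: HarrisKudlaSweet1996, §1 (1.15)] -/
theorem localSiegelCharacter_ne_zero (χv : ∀ w : UnitaryGroup.PlacesOver L v, (w.1.adicCompletion L)ˣ →* ℂˣ) (s : ℂ)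
    {p : UnitaryGroup.localPi L (IsCMField.complexConj L) (n + n) (hermD L e dV hdV dW hdW) v} (hp : p ∈ siegelDeltaLoc L e dV hdV dW hdW v) :
    localSiegelCharacter (Fp L) L (IsCMField.complexConj L) v n χv s p ≠ 0 := by
  rw [localSiegelCharacter]
  refine mul_ne_zero (Units.ne_zero _) fun h => ?_
  have h0 := ((Complex.cpow_eq_zero_iff _ _).1 h).1
  rw [Complex.ofReal_eq_zero, absDetDelta] at h0
  exact (Finset.prod_ne_zero_iff.2 fun w _ => norm_ne_zero_iff.2 (isUnit_localDetDelta_of_mem_siegelDeltaLoc L e dV hdV dW hdW v hp w).ne_zero) h0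

/-- **bridge (law)**: ★ D1's `IsLocalSiegelSection χ_v s F` is the left law `F (p h) = localSiegelCharacter χ_v s p · F h` over the SUBGROUP `siegelDeltaLoc v`
(★ `mem_siegelDeltaLoc_iff_local`) — the currency of §1. [cite: HarrisKudlaSweet1996, §1 (1.15)] -/
theorem isLocalSiegelSection_iff_law (χv : ∀ w : UnitaryGroup.PlacesOver L v, (w.1.adicCompletion L)ˣ →* ℂˣ) (s : ℂ)
    (F : UnitaryGroup.localPi L (IsCMField.complexConj L) (n + n) (hermD L e dV hdV dW hdW) v → ℂ) :
    haveI : Algebra.IsQuadraticExtension (Fp L) L := IsCMField.isQuadraticExtension L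
    IsLocalSiegelSection (Fp L) L (IsCMField.complexConj L) (complexConj_imagUnit L) (imagUnit_ne_zero L) (imagUnit_mul_self L)
        v n (gramR_isSymm L e dV hdV dW hdW) (hermD_eq_map_gramD L e dV hdV dW hdW) χv s F ↔
      ∀ p ∈ siegelDeltaLoc L e dV hdV dW hdW v, ∀ h, F (p * h) = localSiegelCharacter (Fp L) L (IsCMField.complexConj L) v n χv s p * F h := by
  constructor
  · intro hF p hp h
    exact hF p ((mem_siegelDeltaLoc_iff_local L e dV hdV dW hdW v p).1 hp) h
  · intro hF p hp h
    exact hF p ((mem_siegelDeltaLoc_iff_local L e dV hdV dW hdW v p).2 hp) h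

omit [IsCMField L] in
/-- **bridge (smoothness)**: ★ D1's `IsSmooth F` is «right-invariant under an open subgroup» — the currency of §1. [cite: HarrisKudlaSweet1996, §1 (1.15)] -/
theorem isSmooth_iff_exists_subgroup (c : L ≃ₐ[Fp L] L) {J : Matrix (Fin (n + n)) (Fin (n + n)) L}
    (F : UnitaryGroup.localPi L c (n + n) J v → ℂ) :
    IsSmooth (Fp L) L c v n F ↔
      ∃ V : Subgroup (UnitaryGroup.localPi L c (n + n) J v), IsOpen (V : Set (UnitaryGroup.localPi L c (n + n) J v)) ∧
        ∀ h, ∀ u ∈ V, F (h * u) = F h := by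
  constructor
  · rintro ⟨V, hV⟩
    exact ⟨V, V.isOpen, fun h u hu => hV h u hu⟩
  · rintro ⟨V, hVo, hV⟩
    exact ⟨{ toSubgroup := V, isOpen' := hVo }, fun h u hu => hV h u hu⟩

end Local

end Summit.HodgeConjecture.HodgeConjecture.Cruxes.HLiu418.K2LiuLocalSWSpanningCriterion

end
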